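import Summits.BirchSwinnertonDyer.Rank1Residual.O5.O5LayerLaws
import HarnessLib

/-!
# BSD rank-≤1 residual cell, classes O5 ∪ O6 (and every additive prime): the structural
# divisibility `ω_{n−1} ∣ θ_n` of the Mazur–Tate elements at an ADDITIVE prime — ONE typed target
# for all of `Addv W p`, with its restrictions to O5 (o5-r1's T1) and O6 (o6-r1's `piDivisible`)

HONEST FRAMING (cell `b2b-bsdres-*`, run/shared/lean/b2b/bsd-rank1-residual/, verbatim): the goal
of the cell is to DELETE the COMBINATION-SHAPED residual classes for ALL analytic-rank `≤ 1` elliptic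
curves over `ℚ`, not to book instances; census / certificate output is EVIDENCE, never a Literature
fact; nothing here is booked, no mark is moved, O5 and O6 stay OPEN. This file types ONE target
`Prop` (a `def`, nothing asserted) and proves two restriction lemmas; 0 named Literature facts.

## What is typed and why (CLASS-CLOSURE lane, typer 5 = O5/O6 typer of record)

Two planner teams met the same structural fact independently, as EVIDENCE:
* o5-r1 GEN 2 (`O5/O5LayerLaws.lean`, T1 `O5.OmegaDvdMazurTateThree`, binder `ClassO5 W 3`):
  "`ω_{n−1} ∣ θ_n(f_W)` in `ℚ[X]` for `n ≥ 1`" — exact on every (curve, layer) of kit j121751 /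
  j121825 / j122348;
* o6-r1 GEN 2 (`HOME/b2b-bsdres-o6-r1/O6-TOWERS.md` (3.1), interface bit `TowerValuation.piDivisible`):
  "`π_{k→k−1} θ_k = 0`" on 169/169 wild rows.
The mechanism is neither tame nor wild: for ANY additive prime `p` of `E` one has `p² ∣ N_E`, hence
`a_p(E) = 0`, and the Mazur–Tate norm relation at a prime dividing the level,
`cor^{m+1}_m θ_{m+1} = a_p(E)·θ_m` (Mazur–Tate 1987 §1; Doyon–Lei, Lemma 5.2), gives
`cor^{n}_{n−1} θ_n = 0`, i.e. `θ_n = g_{n−1}·ω_{n−1}` with `ω_{n−1} = (1+T)^{p^{n−1}} − 1`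
(Doyon–Lei, proof of Cor. 5.3 — whence their `λ(θ_n) ≥ p^{n−1}` at additive primes, restated in
Lei–Pollack–Pratap arXiv:2412.16629 §1 p. 4 and Lemma 5.1). So the statement is a THEOREM IN PRINT
on the whole additive locus. It is typed HERE, Summits-side, as ONE target `OmegaDvdMazurTateOfAddv`
(a `def … : Prop` for a prover; the tree's `mazurTateElement f p n ∈ ℚ[X]` is the degree-`< p^n`
representative of Pollack 2003 Def. 6.15, so "`cor θ_n = 0` in `ℚ[Γ_{n−1}]`" reads `ω_{n−1} ∣ θ_n` in
`ℚ[X]`), because (i) the tree has as yet no Hecke / `U_p` action on `ratPlusSymbol` from which to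
prove it, and (ii) typer seats of this lane mint no Literature facts — the literature lane may vendor
Doyon–Lei Lemma 5.2 as a named fact, after which this target is discharged by a one-line bridge.
Restrictions proved below: to o5-r1's T1 (`omegaDvdMazurTateThree_of_addv`) and to class O6
(`omegaDvd_mazurTate_three_of_classO6`); both teams may cite the ONE node.

References: B. Mazur, J. Tate, *Refined conjectures of the "Birch and Swinnerton-Dyer type"*, Duke
Math. J. 54 (1987) §1 [MazurTate1987]; A. Doyon, A. Lei, *Congruences between Ramanujan's tau function
and elliptic curves, and Mazur–Tate elements at additive primes*, Ramanujan J. 58 (2022) 505–522,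
Lemma 5.2, Cor. 5.3 [DoyonLei2021]; A. Lei, R. Pollack, N. Pratap, arXiv:2412.16629, §1 and Lemma 5.1
[LeiPollackPratap2024]; R. Pollack, Duke Math. J. 118 (2003) Def. 6.15 [Pollack2003].
## KERNEL STATUS (cc-typer-5 GEN 10 restamp 1, 2026-08-21T23:20Z; statement byte-identical)
**`OmegaDvdMazurTateOfAddv` IS A THEOREM — `omegaDvdMazurTateOfAddv_holds : OmegaDvdMazurTateOfAddv`** (cross-cell pool
hand x11b3-p1 GEN 11, `Additive/OmegaDvdMazurTateAddvHolds.lean` p305243 be0dd44b70eb; this lane's first refusal: no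
objection). Route as the docstring says, at ONE level: for any `f ∈ S₂(Γ₀(N))` and prime `p` whose rational plus symbol
has vanishing fibre sums `∑_{d mod p} [s + d/p]⁺_f = 0` (`cyclotomicOmega_dvd_mazurTateElement_succ_of_sum_ratPlusSymbol_eq_zero`,
the tree's three-term computation of `PlusMinusPAdicLFunctionProofs` §3), `ω_n ∣ θ_{n+1}(f)`; at an ADDITIVE prime the
fibre sums vanish because `a_p(E) = 0` (`sum_ratPlusSymbol_add_div_eq_zero_of_addv`,
`Additive/TwistPartnerRigidityNewform.lean` §2). With it: `O5.omegaDvdMazurTateThree_holds` (O5's T1),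
`Additive.omegaDvdMazurTateAdditiveThree_holds` (O6's T8-i) and x11b3-p3's `lambdaLowerBoundAdditiveThree_holds` (p305956).
The three consumers below (`…_of_addv`, `…_of_classO6`, `X_dvd_…`) are now fed by `omegaDvdMazurTateOfAddv_holds`.
Census numbers stay EVIDENCE; nothing booked; no mark.
-/

set_option autoImplicit false

noncomputable section

open scoped Classical MatrixGroups ModularForm NumberField

open CongruenceSubgroup Polynomial WeierstrassCurve NumberField Literature.NumberTheory.EllipticCurves
  Literature.NumberTheory.EllipticCurves.ModularForms
  Literature.NumberTheory.EllipticCurves.Rank1Residual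

namespace Summit.BirchSwinnertonDyer.Rank1Residual.Additive

/-- **`ω_{n−1} ∣ θ_n` at an ADDITIVE prime (THEOREM IN PRINT; typed target, nothing asserted).**
For every elliptic `W/ℚ` (globally minimal model), its newform `f` (`IsNewformOf W f`), every prime
`p` of ADDITIVE reduction (`Addv W p`: neither good nor multiplicative, so `p² ∣ N_W` and
`a_p(W) = 0`) and every `n ≥ 1`, the polynomial `ω_{n−1} = (1+X)^{p^{n−1}} − 1` divides the
Mazur–Tate element `θ_n(f) ∈ ℚ[X]` (tree `mazurTateElement f p n`, Pollack's degree-`< p^n`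
representative): equivalently the image of `θ_n` in `ℚ[Gal(ℚ_{n−1}/ℚ)]` vanishes. Printed proof: the
norm relation `cor^{m+1}_m θ_{m+1} = a_p·θ_m` for `p ∣ N` (Mazur–Tate 1987 §1; Doyon–Lei Lemma 5.2)
with `a_p = 0` gives `θ_n = g_{n−1}·ω_{n−1}` (Doyon–Lei, proof of Cor. 5.3). Consequences used by
the O5/O6 planners: `θ_n = ω_{n−1} u_n`, `λ(θ_n) = p^{n−1} + λ(u_n)`, `μ(θ_n) = μ(u_n)`.
EVIDENCE (census, not a proof): o5-r1 kit j121751 / j121825 / j122348 (remainder `0` on every O5 row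
and layer), o6-r1 O6-TOWERS (3.1) (169/169 wild rows). A target `Prop` for a prover / for a one-line
bridge from a vendored Doyon–Lei Lemma 5.2; nothing asserted.
[cite: DoyonLei2021, Lemma 5.2 and proof of Cor. 5.3] [cite: MazurTate1987, §1]
[cite: LeiPollackPratap2024, Lemma 5.1]
**PROVED 2026-08-21: `omegaDvdMazurTateOfAddv_holds`** (x11b3-p1 GEN 11, `Additive/OmegaDvdMazurTateAddvHolds.lean`
p305243) — see `## KERNEL STATUS`; statement byte-identical. -/
def OmegaDvdMazurTateOfAddv : Prop :=
  ∀ (W : WeierstrassCurve ℚ) [W.IsElliptic] [W.IsGloballyMinimal] [NeZero (W.conductorNorm ℤ)]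
    (f : CuspForm (Gamma0 (W.conductorNorm ℤ)) 2) (p : ℕ) [Fact p.Prime], IsNewformOf W f → Addv W p →
    ∀ n : ℕ, 1 ≤ n → (cyclotomicOmega p (n - 1)).map (Int.castRingHom ℚ) ∣ mazurTateElement f p n

/-- **Restriction to class O5 = o5-r1's T1.** `OmegaDvdMazurTateOfAddv` implies
`O5.OmegaDvdMazurTateThree` (`O5/O5LayerLaws.lean`), since `ClassO5 W 3 → Addv W 3`
(`ClassO5.addv`). [folklore] -/
theorem omegaDvdMazurTateThree_of_addv (h : OmegaDvdMazurTateOfAddv) : O5.OmegaDvdMazurTateThree := by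
  intro W _ _ _ f hf hO5 n hn
  exact h W f 3 hf hO5.addv.2 n hn

/-- **Restriction to class O6 (wild `p = 3`)** — o6-r1's `piDivisible k` ("`π_{k→k−1} θ_k = 0`",
O6-TOWERS (3.1)) in the tree's vocabulary: on `ClassO6 W 3`, `ω_{n−1} ∣ θ_n(f, 3)` for all `n ≥ 1`,
granted `OmegaDvdMazurTateOfAddv` (`ClassO6 W 3 → Addv W 3`, `ClassO6.addv`). [folklore] -/
theorem omegaDvd_mazurTate_three_of_classO6 (h : OmegaDvdMazurTateOfAddv) (W : WeierstrassCurve ℚ)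
    [W.IsElliptic] [W.IsGloballyMinimal] [NeZero (W.conductorNorm ℤ)]
    (f : CuspForm (Gamma0 (W.conductorNorm ℤ)) 2) (hf : IsNewformOf W f) (hO6 : ClassO6 W 3)
    (n : ℕ) (hn : 1 ≤ n) :
    (cyclotomicOmega 3 (n - 1)).map (Int.castRingHom ℚ) ∣ mazurTateElement f 3 n :=
  h W f 3 hf hO6.addv.2.1 n hn

/-- The first layer: `ω_0 = X`, so the target gives `X ∣ θ_1(f)` at an additive prime — the image of
`θ_1` in `ℚ[Gal(ℚ_0/ℚ)] = ℚ` (its augmentation, `(p−1)`-fold multiple of `[0]⁺`-type sums) vanishes.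
A sanity unfolding of the `n = 1` case; nothing beyond the hypothesis. [folklore] -/
theorem X_dvd_mazurTateElement_one_of_addv (h : OmegaDvdMazurTateOfAddv) (W : WeierstrassCurve ℚ)
    [W.IsElliptic] [W.IsGloballyMinimal] [NeZero (W.conductorNorm ℤ)]
    (f : CuspForm (Gamma0 (W.conductorNorm ℤ)) 2) (p : ℕ) [Fact p.Prime] (hf : IsNewformOf W f)
    (hadd : Addv W p) : (X : ℚ[X]) ∣ mazurTateElement f p 1 := by
  have h1 := h W f p hf hadd 1 le_rfl
  simpa [cyclotomicOmega, Polynomial.map_sub, Polynomial.map_pow, Polynomial.map_add] using h1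

end Summit.BirchSwinnertonDyer.Rank1Residual.Additive

end
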